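/-
Copyright (c) 2026 the pub-hodgecm-mathlib formalisation cell (harness21).  Prover seat hodgecm-mathlib-K2Liu-p13 (g0), Track B «K2-LIT»,
#184♮ = hLiu418 = `stmt-HodgeConjecture-24832`; LEAD F0P6-plan (g12) RE-KEY 2026-09-04T08:03:21Z «U1-CT-ind STAGE 1∕2 + shared #42S S1∕S2 local block»;
co-dealer K2E5-plan (g6) CAVEAT (CC-1) 08:05:31Z; CENSUS-FIRST `K2/K2Liu-p13/g0/CENSUS-FIRST-U1stage12.K2Liu-p13-g0.md` 0da41888f0faf34c, BRICK 1.
-/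
import Literature.NumberTheory.K2Lit.SiegelStandardExtension                                   -- ★ O42.3d: `stdExtension`, `pPart`, `kPart`
import Summits.HodgeConjecture.HodgeConjecture.Theorems.K2LiuIwasawaDeltaUnimodular             -- ★ every Iwasawa datum is `Δ`-unimodular
import HarnessLib

/-!
# Crux `HLiu418`, Road I v3, organ U1 (stage 1), BRICK 1: THE STANDARD EXTENSION DOES NOT SEE THE IWASAWA DATUM INSIDE A CHAIN
# `𝒦.K ≤ 𝒦⁺.K ⇒ stdExtension 𝒦⁺ s₀ φ = stdExtension 𝒦 s₀ φ`, and a `𝒦`-standard family is `𝒦⁺`-standard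

Cell `hodgecm-mathlib`, crux item hLiu418 = `stmt-HodgeConjecture-24832`, route `HCCMUnconditional`; squad K2 ∕ K2Liu, LEAD F0P6-plan (g12), co-dealer
K2E5-plan (g6); prover seat K2Liu-p13 (g0).  THEOREMS ONLY (no `def`, no instance, no notation, no named-fact hypothesis, no `sorry`); lane
`--supports stmt-HodgeConjecture-24832 --as helper` (count-neutral).

WHY (caveat (CC-1) of the road sheet `K2/K2E5-plan/g6/SIGS-RoadI-v3.md` §U1).  The U6 sockets #41 ∕ #42S ∕ #42F′ quantify over EVERY STANDARD Iwasawa datum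
`𝒦` (★ `IwasawaDatum.IsStd`: `𝒦.K = C_∞ · C_f` with `C_f` OPEN in `H(𝔸_f)`, and only the GLOBAL Iwasawa decomposition `H(𝔸) = P_Δ(𝔸)·𝒦.K` of ★ `IwasawaDatum`).
Such a `C_f` need NOT be a product `∏_v K_v` of local compact open subgroups (fibre-product level structures linking two places are open and globally
Iwasawa), and then the flat extension ★ `stdExtension 𝒦 s₀ φ` of a pure tensor `φ = ⊗_v φ_v` is NOT a tensor product of local flat extensions: the local
organs of Road I (U1-fin, (A4′-R)∕(A4″-KR), #42S S1) cannot read a «local component» off the global family directly.  THE REPAIR is that the family does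
not change when `𝒦` is ENLARGED: for Iwasawa data `𝒦, 𝒦⁺` with `𝒦.K ≤ 𝒦⁺.K` (nothing else) the chosen decomposition `h = (𝒦.pPart h)(𝒦.kPart h)` is also a
`𝒦⁺`-decomposition, so the two `P_Δ`-parts have the same modulus (★ `IwasawaDatum.modDelta_pPart_eq`, unimodularity of `𝒦⁺` along `Δ`), whence

* **`modDelta_pPart_eq_of_le`** (M1): `|det_Δ (𝒦⁺.pPart h)| = |det_Δ (𝒦.pPart h)|` for every `h`;
* **`stdExtension_eq_of_le`** (M2): `stdExtension 𝒦⁺ s₀ φ = stdExtension 𝒦 s₀ φ` — equality of families, NO hypothesis on `φ`;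
* **`flat_of_le`** (M3): a family of Siegel sections (★ `IsSiegelDeltaSectionFamily`) that is flat on `𝒦.K` (`f s k = f s' k`) is flat on `𝒦⁺.K`
  (`k⁺ = p k` with `|det_Δ p| = 1`, so `f s k⁺ = χ(det_Δ p) · f s k`);
* **`isKFinite_of_le`** (M4): `IsKFinite 𝒦 φ → IsKFinite 𝒦⁺ φ` when `𝒦⁺.K ⊆ T · 𝒦.K` for a FINITE set `T` (finite index; the right translate by `k⁺ = t k` is
  the `t`-translate of a `k`-translate);
* **`isStandardSectionFamily_of_le`** (M5): `IsStandardSectionFamily 𝒦 χ f → IsStandardSectionFamily 𝒦⁺ χ f` under the same finite-index witness;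
* the same five with the unimodularity clause DISCHARGED by ★ `K2LiuIwasawaDeltaUnimodular` (non-degenerate frames `dV i ≠ 0`, `dW i ≠ 0`):
  `stdExtension_eq_of_le'`, `isStandardSectionFamily_of_le'`.

USE (bricks 2–3 of the census).  Brick 2 `K2LiuIsStdPlaceAdapted` puts every standard `𝒦` inside a standard `𝒦⁺ ⊇ 𝒦` of finite index whose finite part
is a PRODUCT AT a given finite place `v` with a locally-Iwasawa compact open `K_v` (`H_v = P_{Δ,v} K_v`); by (M2)∕(M5) the standard family of the sockets
(`gΦ = detChar · stdExtension 𝒦 …`) is LITERALLY the one built from `𝒦⁺`, and every local face may assume a `v`-adapted datum «`K₀` BY VALUE with an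
Iwasawa hypothesis» without loss.  The residue form ★ `resGen` is a function of the family, hence unchanged.
[KudlaRallis1994, §1 (standard sections `Φ(s)`)], [Tan1999, §1 p. 166], [HarrisKudlaSweet1996, §1 (1.15)–(1.17)], [MoeglinWaldspurger1995, II.1.5 (`m_P` trivial on `K ∩ P`)].
HONEST LABEL.  Count-neutral helper; `HC_CM` is proved only modulo the 7 printed citations (2 remaining named inputs: hLiu418 =
`stmt-HodgeConjecture-24832`, h413 = `stmt-HodgeConjecture-24833`) until rung 0 closes.
-/

set_option autoImplicit false
set_option linter.dupNamespace false -- the mandated namespace repeats `HodgeConjecture.HodgeConjecture`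

noncomputable section

open NumberField IsDedekindDomain
open scoped Matrix

namespace Summit.HodgeConjecture.HodgeConjecture.Cruxes.HLiu418.K2LiuStdExtensionDatumMonotone

open Literature.NumberTheory.Automorphic hiding IsKFinite
open Literature.NumberTheory.GaloisRepresentations
open Literature.NumberTheory.GelbartRogawski1991 Literature.NumberTheory.GelbartRogawski1991.GRConstruction
open Literature.NumberTheory.K2Lit.SiegelDoubled
open Summit.HodgeConjecture.HodgeConjecture.Cruxes.HLiu418.K2LiuIwasawaDeltaUnimodular

variable {L : Type} [Field L] [NumberField L] [IsCMField L]
variable {N M n : ℕ} {e : Fin N × Fin M ≃ Fin n}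
  {dV : Fin N → L} {hdV : ∀ i, IsCMField.complexConj L (dV i) = dV i}
  {dW : Fin M → L} {hdW : ∀ i, IsCMField.complexConj L (dW i) = dW i}
variable {𝒦 𝒦' : IwasawaDatum L e dV hdV dW hdW}

/-! ## §1 The modulus of the `P_Δ`-part and the standard extension are datum-monotone -/

/-- **(M1)** for Iwasawa data `𝒦.K ≤ 𝒦⁺.K` (`𝒦⁺` unimodular along `Δ`), the chosen `P_Δ`-parts of `h` for the two data have the same modulus:
`|det_Δ (𝒦⁺.pPart h)|^{1/2} = |det_Δ (𝒦.pPart h)|^{1/2}` — `h = (𝒦.pPart h)(𝒦.kPart h)` is also a `𝒦⁺`-decomposition. [cite: Tan1999, §1 p. 166]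
[cite: MoeglinWaldspurger1995, II.1.5] -/
theorem modDelta_pPart_eq_of_le (hK' : 𝒦'.IsDeltaUnimodular) (hle : 𝒦.K ≤ 𝒦'.K) (h : HA L e dV hdV dW hdW) :
    modDelta L e dV hdV dW hdW (𝒦'.pPart h) = modDelta L e dV hdV dW hdW (𝒦.pPart h) :=
  IwasawaDatum.modDelta_pPart_eq hK' (𝒦.pPart_isSiegelDelta h) (hle (𝒦.kPart_mem h)) (𝒦.pPart_mul_kPart h).symm

/-- **(M2) THE STANDARD EXTENSION DOES NOT SEE THE DATUM INSIDE A CHAIN**: `stdExtension 𝒦⁺ s₀ φ = stdExtension 𝒦 s₀ φ` whenever `𝒦.K ≤ 𝒦⁺.K`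
(`𝒦⁺` unimodular along `Δ`); no hypothesis on `φ`. [cite: KudlaRallis1994, §1] [cite: Tan1999, §1 p. 166] [cite: HarrisKudlaSweet1996, §1 (1.17)] -/
theorem stdExtension_eq_of_le (hK' : 𝒦'.IsDeltaUnimodular) (hle : 𝒦.K ≤ 𝒦'.K) (s₀ : ℂ) (φ : HA L e dV hdV dW hdW → ℂ) :
    stdExtension 𝒦' s₀ φ = stdExtension 𝒦 s₀ φ := by
  funext s h
  simp only [stdExtension, modDelta_pPart_eq_of_le hK' hle h]

/-! ## §2 Flatness, `K`-finiteness and standardness transfer upwards -/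

/-- the inducing character is `s`-INDEPENDENT on an element of modulus one: `χ_s(p) = χ_{s'}(p)` when `|det_Δ p|^{1/2} = 1`. [cite: Tan1999, §1 p. 166] -/
theorem siegelDeltaCharacter_eq_of_modDelta_eq_one (χ : HeckeCharacter L) {p : HA L e dV hdV dW hdW}
    (hp : modDelta L e dV hdV dW hdW p = 1) (s s' : ℂ) :
    siegelDeltaCharacter L e dV hdV dW hdW χ s p = siegelDeltaCharacter L e dV hdV dW hdW χ s' p := by
  unfold siegelDeltaCharacter
  rw [hp, Complex.ofReal_one, Complex.one_cpow, Complex.one_cpow]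

/-- the `𝒦`-chosen `P_Δ`-part of an element of the BIGGER compact group `𝒦⁺.K` has modulus one. [cite: MoeglinWaldspurger1995, II.1.5] [cite: Tan1999, §1 p. 166] -/
theorem modDelta_pPart_eq_one_of_mem (hK' : 𝒦'.IsDeltaUnimodular) (hle : 𝒦.K ≤ 𝒦'.K) {k : HA L e dV hdV dW hdW} (hk : k ∈ 𝒦'.K) :
    modDelta L e dV hdV dW hdW (𝒦.pPart k) = 1 := by
  rw [← modDelta_pPart_eq_of_le hK' hle k, IwasawaDatum.modDelta_pPart_of_mem_K hK' hk]

/-- **(M3) FLATNESS TRANSFERS UPWARDS**: a family of Siegel sections of `I(s, χ)` that is flat on `𝒦.K` is flat on every bigger `𝒦⁺.K`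
(`k⁺ = p k`, `p ∈ P_Δ(𝔸)` of modulus one, `k ∈ 𝒦.K`: `f s k⁺ = χ(det_Δ p) · f s k`). [cite: Tan1999, §1 p. 166] [cite: HarrisKudlaSweet1996, §1 (1.17)] -/
theorem flat_of_le (hK' : 𝒦'.IsDeltaUnimodular) (hle : 𝒦.K ≤ 𝒦'.K) {χ : HeckeCharacter L} {f : ℂ → HA L e dV hdV dW hdW → ℂ}
    (hf : IsSiegelDeltaSectionFamily L e dV hdV dW hdW χ f) (hflat : ∀ k : HA L e dV hdV dW hdW, k ∈ 𝒦.K → ∀ s s' : ℂ, f s k = f s' k) :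
    ∀ k : HA L e dV hdV dW hdW, k ∈ 𝒦'.K → ∀ s s' : ℂ, f s k = f s' k := by
  intro k hk s s'
  have hdec : k = 𝒦.pPart k * 𝒦.kPart k := (𝒦.pPart_mul_kPart k).symm
  rw [hdec, hf s _ (𝒦.pPart_isSiegelDelta k), hf s' _ (𝒦.pPart_isSiegelDelta k),
    siegelDeltaCharacter_eq_of_modDelta_eq_one χ (modDelta_pPart_eq_one_of_mem hK' hle hk) s s',
    hflat _ (𝒦.kPart_mem k) s s']

/-- **(M4) `K`-FINITENESS TRANSFERS UPWARDS UNDER FINITE INDEX**: if `𝒦⁺.K ⊆ T · 𝒦.K` for a finite set `T ⊆ H(𝔸)` (finitely many left `𝒦.K`-cosets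
cover `𝒦⁺.K`), a `𝒦`-finite `φ` is `𝒦⁺`-finite: the right translate by `k⁺ = t k` is the right `t`-translate of the right `k`-translate, so the
`𝒦⁺`-span lies in the finite sum over `t ∈ T` of the `t`-translates of the `𝒦`-span. [cite: HarrisKudlaSweet1996, §1 (1.16)] [cite: BorelJacquet1979, §4.1] -/
theorem isKFinite_of_le (T : Finset (HA L e dV hdV dW hdW))
    (hT : ∀ k : HA L e dV hdV dW hdW, k ∈ 𝒦'.K → ∃ t ∈ T, ∃ k₀ ∈ 𝒦.K, k = t * k₀)
    {φ : HA L e dV hdV dW hdW → ℂ} (hφ : IsKFinite 𝒦 φ) : IsKFinite 𝒦' φ := by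
  classical
  -- right translation by a fixed `t` as a linear map
  let R : HA L e dV hdV dW hdW → (HA L e dV hdV dW hdW → ℂ) →ₗ[ℂ] (HA L e dV hdV dW hdW → ℂ) := fun t =>
    { toFun := fun ψ h => ψ (h * t)
      map_add' := fun ψ ψ' => rfl
      map_smul' := fun c ψ => rfl }
  have hle : rightTranslateSpan 𝒦' φ ≤ T.sup fun t => (rightTranslateSpan 𝒦 φ).map (R t) := by
    refine Submodule.span_le.2 ?_
    rintro _ ⟨k, rfl⟩
    obtain ⟨t, ht, k₀, hk₀, hk⟩ := hT k k.2
    have hmem : (fun h : HA L e dV hdV dW hdW => φ (h * (k : HA L e dV hdV dW hdW))) ∈ (rightTranslateSpan 𝒦 φ).map (R t) := by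
      refine ⟨fun h => φ (h * k₀), rightTranslate_mem_rightTranslateSpan 𝒦 φ hk₀, funext fun h => ?_⟩
      show φ (h * t * k₀) = φ (h * (k : HA L e dV hdV dW hdW))
      rw [hk, mul_assoc]
    exact (Finset.le_sup (f := fun t => (rightTranslateSpan 𝒦 φ).map (R t)) ht) hmem
  unfold IsKFinite at *
  haveI := hφ
  exact Submodule.finiteDimensional_of_le hle

/-- **(M5) A `𝒦`-STANDARD FAMILY IS `𝒦⁺`-STANDARD** for every bigger Iwasawa datum `𝒦⁺` of finite index over `𝒦` (`𝒦⁺` unimodular along `Δ`):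
holomorphy is datum-free, flatness by (M3), `K`-finiteness by (M4). [cite: Tan1999, §1 p. 166] [cite: KudlaRallis1994, §1] [cite: HarrisKudlaSweet1996, §1 (1.15)–(1.17)] -/
theorem isStandardSectionFamily_of_le (hK' : 𝒦'.IsDeltaUnimodular) (hle : 𝒦.K ≤ 𝒦'.K) (T : Finset (HA L e dV hdV dW hdW))
    (hT : ∀ k : HA L e dV hdV dW hdW, k ∈ 𝒦'.K → ∃ t ∈ T, ∃ k₀ ∈ 𝒦.K, k = t * k₀)
    {χ : HeckeCharacter L} {f : ℂ → HA L e dV hdV dW hdW → ℂ} (hf : IsStandardSectionFamily 𝒦 χ f) :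
    IsStandardSectionFamily 𝒦' χ f :=
  ⟨hf.1, fun s => isKFinite_of_le T hT (hf.2.1 s), flat_of_le hK' hle hf.1.1 hf.2.2⟩

/-- the standard extension along `𝒦` of the value `f s₀` of a `𝒦`-FLAT family of sections IS the family (a flat family is determined by one value);
recorded here because the local faces read `f` as `stdExtension 𝒦⁺ s₀ (f s₀)` for the adapted datum. [cite: KudlaRallis1994, §1] [cite: Tan1999, §1 p. 166] -/
theorem stdExtension_apply_eq_of_flat {χ : HeckeCharacter L} {f : ℂ → HA L e dV hdV dW hdW → ℂ}
    (hf : IsSiegelDeltaSectionFamily L e dV hdV dW hdW χ f) (hflat : ∀ k : HA L e dV hdV dW hdW, k ∈ 𝒦.K → ∀ s s' : ℂ, f s k = f s' k)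
    (s₀ s : ℂ) (h : HA L e dV hdV dW hdW) : stdExtension 𝒦 s₀ (f s₀) s h = f s h := by
  have hdec : h = 𝒦.pPart h * 𝒦.kPart h := (𝒦.pPart_mul_kPart h).symm
  have hP := 𝒦.pPart_isSiegelDelta h
  have hpos : 0 < modDelta L e dV hdV dW hdW (𝒦.pPart h) := modDelta_pos L e dV hdV dW hdW _
  have hne : ((modDelta L e dV hdV dW hdW (𝒦.pPart h) : ℝ) : ℂ) ≠ 0 := Complex.ofReal_ne_zero.2 hpos.ne'
  have h0 := hf s₀ _ hP (𝒦.kPart h)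
  have hs := hf s _ hP (𝒦.kPart h)
  rw [← hdec] at h0 hs
  rw [stdExtension, h0, hs, ← hflat _ (𝒦.kPart_mem h) s₀ s]
  unfold siegelDeltaCharacter
  have hexp : ((modDelta L e dV hdV dW hdW (𝒦.pPart h) : ℝ) : ℂ) ^ (2 * s + (n : ℂ)) =
      ((modDelta L e dV hdV dW hdW (𝒦.pPart h) : ℝ) : ℂ) ^ (2 * (s - s₀)) *
        ((modDelta L e dV hdV dW hdW (𝒦.pPart h) : ℝ) : ℂ) ^ (2 * s₀ + (n : ℂ)) := by
    rw [← Complex.cpow_add _ _ hne]; ring_nf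
  rw [hexp]; ring

/-! ## §3 The unimodularity clause discharged (non-degenerate frames) -/

section Discharged

variable (hdV0 : ∀ i, dV i ≠ 0) (hdW0 : ∀ i, dW i ≠ 0)
include hdV0 hdW0

/-- **(M2′)** `stdExtension 𝒦⁺ s₀ φ = stdExtension 𝒦 s₀ φ` for `𝒦.K ≤ 𝒦⁺.K`, unconditionally on a non-degenerate frame (★ `K2LiuIwasawaDeltaUnimodular`:
every Iwasawa datum is unimodular along `Δ`). [cite: KudlaRallis1994, §1] [cite: Tan1999, §1 p. 166] -/
theorem stdExtension_eq_of_le' (hle : 𝒦.K ≤ 𝒦'.K) (s₀ : ℂ) (φ : HA L e dV hdV dW hdW → ℂ) :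
    stdExtension 𝒦' s₀ φ = stdExtension 𝒦 s₀ φ :=
  stdExtension_eq_of_le (IwasawaDatum.modDelta_eq_one_of_mem L e dV hdV hdV0 dW hdW hdW0 𝒦') hle s₀ φ

/-- **(M5′)** a `𝒦`-standard family is `𝒦⁺`-standard for every bigger Iwasawa datum of finite index, unconditionally on a non-degenerate frame.
[cite: Tan1999, §1 p. 166] [cite: HarrisKudlaSweet1996, §1 (1.15)–(1.17)] -/
theorem isStandardSectionFamily_of_le' (hle : 𝒦.K ≤ 𝒦'.K) (T : Finset (HA L e dV hdV dW hdW))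
    (hT : ∀ k : HA L e dV hdV dW hdW, k ∈ 𝒦'.K → ∃ t ∈ T, ∃ k₀ ∈ 𝒦.K, k = t * k₀)
    {χ : HeckeCharacter L} {f : ℂ → HA L e dV hdV dW hdW → ℂ} (hf : IsStandardSectionFamily 𝒦 χ f) :
    IsStandardSectionFamily 𝒦' χ f :=
  isStandardSectionFamily_of_le (IwasawaDatum.modDelta_eq_one_of_mem L e dV hdV hdV0 dW hdW hdW0 𝒦') hle T hT hf

/-- **(M6′)** a `𝒦`-standard family is the standard extension ALONG ANY BIGGER DATUM of any of its values: `f s h = stdExtension 𝒦⁺ s₀ (f s₀) s h`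
(`𝒦.K ≤ 𝒦⁺.K`, non-degenerate frame). [cite: KudlaRallis1994, §1] [cite: Tan1999, §1 p. 166] -/
theorem eq_stdExtension_of_le' (hle : 𝒦.K ≤ 𝒦'.K) {χ : HeckeCharacter L} {f : ℂ → HA L e dV hdV dW hdW → ℂ}
    (hf : IsStandardSectionFamily 𝒦 χ f) (s₀ s : ℂ) (h : HA L e dV hdV dW hdW) :
    f s h = stdExtension 𝒦' s₀ (f s₀) s h := by
  rw [stdExtension_eq_of_le' hdV0 hdW0 hle,
    stdExtension_apply_eq_of_flat hf.1.1 hf.2.2 s₀ s h]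

end Discharged

end Summit.HodgeConjecture.HodgeConjecture.Cruxes.HLiu418.K2LiuStdExtensionDatumMonotone

end
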